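import Summits.QuantumFields.YangMills.Theorems.F4SubCurvatureDoorShortRootRigiditySliceDensity
import Summits.QuantumFields.YangMills.Theorems.F4SubCurvatureDoorLowDegreeChannels
import Mathlib
import HarnessLib

/-!
# Route `F4SubCurvatureDoor`, crux ⟨stmt-QuantumFields-23035⟩ `ShortRootRigidity`: LINE g19-A «transverse slice» (planner ym-idea-3 g19,
# tree skeleton `Cruxes/ShortRootRigidity/Lines/transverse_slice.lean`) — geometry and estimates of the transverse slices
# `slice K a (y) = ∫_{ℝ²} K(ι y + ι^⊥ x) · cos⟪a,x⟫ e^{−‖x‖²/2} dx` (toward the registered stub (1) `stub_sliceInClass`)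

Def-free support for six of the seven conjuncts of `InPlanarClass (slice K a)` (the defs `E2`, `planeEmb` = `ι`, `perpEmb` = `ι^⊥`,
`weight`, `slice` are those of ✓`F4SubCurvatureDoorSliceDensityRegistered`, verbatim copies of the skeleton's):

* frame identities: `ι(−y) = −ι y`, `ι(θ₂ y) + ι^⊥ x = θ₄(ι y + ι^⊥ x)`, `θ₄(ι yᵢ + ι^⊥ u) − (ι yⱼ + ι^⊥ u') = ι(θ₂ yᵢ − yⱼ) + ι^⊥(u − u')`,
  `Σₖ (ι y + ι^⊥ x)ₖ = y₀ + √3 y₁`, and ★ `diagReflection_planeEmb_add_perpEmb`: the diagonal short-root reflection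
  `S : z ↦ z − ½(Σ zₖ)(1,1,1,1)` of the tree (`exists_diag_reflection`, a `D₄`-preserving isometry) acts on the slice frame as the
  HEXAGONAL reflection `σ_{n'}` of the plane, `n' = (½, √3/2)` (`S` fixes `Π₀^⊥` pointwise);
* symmetries (conjuncts 3, 4, 5): `slice_timeReflection` (`θ₂`, via `W(B₄) ∋ θ₄`), `slice_hexReflection` (via `S`), `slice_neg` (`K` even);
* `exists_bound_of_le_norm`: a kernel continuous off `0` and bounded outside the unit ball is bounded on `{‖z‖ ≥ r}`, `r > 0`;
* conjunct 1 `continuousOn_slice` (dominated convergence off `0`) and conjunct 2 `exists_bound_slice` (`|slice| ≤ C⁺ ∫ e^{−‖x‖²/2}` on `‖y‖ ≥ 1`);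
* conjunct 7 ★ `tendsto_norm_pow_six_mul_slice`: the PLANAR SUB-CURVATURE BUDGET `‖y‖⁶ · slice K a y → 0` (`y → 0`, `y ≠ 0`) from the
  four-dimensional budget `‖z‖⁸ K z → 0`, through the pointwise bound `η ((‖y‖² + ‖x‖²)^4)⁻¹ + M_{δ/2} e^{−‖x‖²/2}` and the scaling
  identity `∫_{ℝ²} ((s² + ‖x‖²)^4)⁻¹ dx = s⁻⁶ ∫_{ℝ²} ((1 + ‖v‖²)^4)⁻¹ dv` (`integral_inv_sq_add_norm_sq_pow_four`, Mathlib
  `Measure.integral_comp_inv_smul_of_nonneg` + `integrable_rpow_neg_one_add_norm_sq`).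

The remaining conjunct 6 (reflection positivity inside the plane) and the registered stub itself are in the sibling modules
`F4SubCurvatureDoorGaussCosinePositivity` / `F4SubCurvatureDoorShortRootRigiditySliceInClass`.

THEOREMS ONLY; Mathlib + tree; no `sorry`; standard axioms.  HONEST FRAMING: routine measure theory for support stub (1) (M–L) of a
freshly filed line; the heart `stub_planarRigidity` (XL), stub (4), crux 23035 / 23125, rung R2d (`BalabanLadder.ROT`) and every summit
statement are untouched; the Yang–Mills mass gap is NOT proved.  Width seat `ym-line-sfw-p2-w3` g36 (cell ym-idea-1, free hands),
`--supports stmt-QuantumFields-23035`. [folklore]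
-/

set_option autoImplicit false

noncomputable section

namespace Summit.QuantumFields.YangMills.Theorems.F4SubCurvatureDoorSliceInClass

open scoped Topology BigOperators RealInnerProductSpace
open Filter Set MeasureTheory
open Literature.MathematicalPhysics.QuantumLattice (timeReflection timeReflection_apply siteToE)
open Summit.QuantumFields.YangMills.Cruxes.OSLegsAtWeakCouplingC.Sketch (IsSignedPerm)
open Summit.QuantumFields.YangMills.Theorems.F4SubCurvatureDoorMirrorAnalyticityRegistered (E4 InClass)
open Summit.QuantumFields.YangMills.Theorems.F4SubCurvatureDoorGlobalReduction (isSignedPerm_neg isSignedPerm_reflection_single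
  timeReflection_eq_reflection_single)
open Summit.QuantumFields.YangMills.Theorems.F4SubCurvatureDoorSliceDensityRegistered
  (E2 planeEmb perpEmb weight slice planeEmb_add_perpEmb_apply_zero norm_sq_planeEmb_add_perpEmb perpEmb_neg
   continuous_perpEmb planeEmb_add_perpEmb_ne_zero continuous_comp_slice exists_bound_comp_slice)
open Summit.QuantumFields.YangMills.Theorems.F4SubCurvatureDoorLowDegreeChannels (exists_diag_reflection)

/-! ## Frame identities -/

/-- `ι(−y) = −ι y`. -/
theorem planeEmb_neg (y : E2) : planeEmb (-y) = -planeEmb y := by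
  ext i
  simp only [planeEmb, WithLp.equiv_symm_apply, PiLp.neg_apply, PiLp.toLp_apply]
  fin_cases i <;> simp <;> ring

/-- `ι` is continuous. -/
theorem continuous_planeEmb : Continuous planeEmb := by
  unfold planeEmb
  simp only [WithLp.equiv_symm_apply]
  refine (PiLp.continuous_toLp 2 _).comp ?_
  refine continuous_pi fun i => ?_
  fin_cases i <;> simp <;> fun_prop

/-- The planar time reflection lifts to the four-dimensional one: `ι(θ₂ y) + ι^⊥ x = θ₄ (ι y + ι^⊥ x)`
(`θ₄` fixes `Π₀^⊥ ⊂ {x₀ = 0}` pointwise). -/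
theorem planeEmb_timeReflection_add_perpEmb (y x : E2) :
    planeEmb (timeReflection 2 y) + perpEmb x = timeReflection 4 (planeEmb y + perpEmb x) := by
  ext i
  simp only [planeEmb, perpEmb, WithLp.equiv_symm_apply, PiLp.add_apply, timeReflection_apply]
  fin_cases i <;> simp

/-- The mixed difference used in reflection positivity: `θ₄(ι yᵢ + ι^⊥ u) − (ι yⱼ + ι^⊥ u') = ι(θ₂ yᵢ − yⱼ) + ι^⊥(u − u')`. -/
theorem timeReflection_planeEmb_sub (y y' u u' : E2) :
    timeReflection 4 (planeEmb y + perpEmb u) - (planeEmb y' + perpEmb u') =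
      planeEmb (timeReflection 2 y - y') + perpEmb (u - u') := by
  ext i
  simp only [planeEmb, perpEmb, WithLp.equiv_symm_apply, PiLp.add_apply, PiLp.sub_apply, timeReflection_apply]
  fin_cases i <;> simp <;> ring

/-- The four-dimensional time reflection is a signed permutation (it is the mirror `x₀ ↦ −x₀`). -/
theorem isSignedPerm_timeReflection : IsSignedPerm (timeReflection 4) := by
  intro i
  obtain ⟨j, hj⟩ := isSignedPerm_reflection_single (0 : Fin 4) i
  refine ⟨j, ?_⟩
  rw [timeReflection_eq_reflection_single]
  exact hj

/-- `1/√3 = √3/3`. -/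
theorem inv_sqrt_three : (Real.sqrt 3)⁻¹ = Real.sqrt 3 / 3 := by
  have h : Real.sqrt 3 * Real.sqrt 3 = 3 := Real.mul_self_sqrt (by norm_num)
  have h0 : Real.sqrt 3 ≠ 0 := by positivity
  field_simp
  nlinarith [h]

/-- The coordinate sum of `ι y + ι^⊥ x` is `y₀ + √3·y₁` (`Π₀^⊥ ⊥ (1,1,1,1)`). -/
theorem sum_planeEmb_add_perpEmb (y x : E2) : ∑ k, (planeEmb y + perpEmb x) k = y 0 + Real.sqrt 3 * y 1 := by
  simp only [Fin.sum_univ_four, planeEmb, perpEmb, WithLp.equiv_symm_apply, PiLp.add_apply]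
  simp only [Matrix.cons_val_zero, Matrix.cons_val_one, Matrix.cons_val]
  simp only [div_eq_mul_inv, inv_sqrt_three]
  ring

/-- **The diagonal short-root reflection acts on the slice frame as the hexagonal reflection of the plane**:
for the reflection `S : z ↦ z − ½(Σ zₖ)(1,1,1,1)` (tree: `exists_diag_reflection`),
`S (ι y + ι^⊥ x) = ι (σ_{n'} y) + ι^⊥ x` with `σ_{n'} y = (y₀/2 − (√3/2) y₁, −(√3/2) y₀ − y₁/2)` (`S` fixes `Π₀^⊥` pointwise). -/
theorem diagReflection_planeEmb_add_perpEmb (S : E4 ≃ₗᵢ[ℝ] E4) (hS : ∀ (z : E4) (i : Fin 4), S z i = z i - (1 / 2) * ∑ k, z k)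
    (y x : E2) :
    S (planeEmb y + perpEmb x) =
      planeEmb ((WithLp.equiv 2 (Fin 2 → ℝ)).symm ![y 0 / 2 - Real.sqrt 3 / 2 * y 1, -(Real.sqrt 3 / 2 * y 0) - y 1 / 2]) +
        perpEmb x := by
  ext i
  rw [hS, sum_planeEmb_add_perpEmb]
  simp only [planeEmb, perpEmb, WithLp.equiv_symm_apply, PiLp.add_apply]
  have h : Real.sqrt 3 * Real.sqrt 3 = 3 := Real.mul_self_sqrt (by norm_num)
  fin_cases i <;> simp [div_eq_mul_inv, inv_sqrt_three] <;>
    first | ring1 | linear_combination (y 0 / 6) * h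

/-! ## Symmetries of the slices -/

variable {K : E4 → ℝ}

/-- `θ₂`-invariance of every slice of a `W(B₄)`-invariant kernel. -/
theorem slice_timeReflection (hB4 : ∀ R : E4 ≃ₗᵢ[ℝ] E4, IsSignedPerm R → ∀ x, K (R x) = K x) (a y : E2) :
    slice K a (timeReflection 2 y) = slice K a y := by
  unfold slice
  congr 1
  funext x
  rw [planeEmb_timeReflection_add_perpEmb, hB4 _ isSignedPerm_timeReflection]

/-- Hexagonal invariance of every slice of a kernel invariant under the diagonal short-root reflection. -/
theorem slice_hexReflection (S : E4 ≃ₗᵢ[ℝ] E4) (hS : ∀ (z : E4) (i : Fin 4), S z i = z i - (1 / 2) * ∑ k, z k)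
    (hKS : ∀ z, K (S z) = K z) (a y : E2) :
    slice K a ((WithLp.equiv 2 (Fin 2 → ℝ)).symm ![y 0 / 2 - Real.sqrt 3 / 2 * y 1, -(Real.sqrt 3 / 2 * y 0) - y 1 / 2]) =
      slice K a y := by
  unfold slice
  congr 1
  funext x
  rw [← diagReflection_planeEmb_add_perpEmb S hS, hKS]

/-- The Gaussian–cosine weight is even. -/
theorem weight_neg (a x : E2) : weight a (-x) = weight a x := by
  simp [weight, inner_neg_right, Real.cos_neg, norm_neg]

/-- Evenness of every slice of an even kernel (`x ↦ −x` preserves Lebesgue measure and the weight). -/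
theorem slice_neg (heven : ∀ v : E4, K (-v) = K v) (a y : E2) : slice K a (-y) = slice K a y := by
  unfold slice
  have h1 : ∀ x : E2, K (planeEmb (-y) + perpEmb x) = K (planeEmb y + perpEmb (-x)) := fun x => by
    rw [planeEmb_neg, perpEmb_neg, ← heven, neg_add, neg_neg]
  simp_rw [h1]
  have h2 := integral_neg_eq_self (fun x : E2 => K (planeEmb y + perpEmb x) * weight a (-x)) volume
  simp only [neg_neg] at h2
  rw [h2]
  simp_rw [weight_neg]

/-! ## Size of the integrand -/

/-- `|w_a(x)| ≤ e^{−‖x‖²/2}`. -/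
theorem abs_weight_le (a x : E2) : |weight a x| ≤ Real.exp (-(‖x‖ ^ 2 / 2)) := by
  rw [weight, abs_mul, Real.abs_exp]
  exact mul_le_of_le_one_left (Real.exp_pos _).le (Real.abs_cos_le_one _)

/-- The weight is continuous. -/
theorem continuous_weight (a : E2) : Continuous (weight a) := by
  unfold weight; fun_prop

/-- `‖y‖ ≤ ‖ι y + ι^⊥ x‖`. -/
theorem norm_le_norm_planeEmb_add_perpEmb (y x : E2) : ‖y‖ ≤ ‖planeEmb y + perpEmb x‖ := by
  have h := norm_sq_planeEmb_add_perpEmb y x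
  nlinarith [norm_nonneg y, norm_nonneg x, norm_nonneg (planeEmb y + perpEmb x)]

/-- `‖x‖ ≤ ‖ι y + ι^⊥ x‖`. -/
theorem norm_le_norm_planeEmb_add_perpEmb' (y x : E2) : ‖x‖ ≤ ‖planeEmb y + perpEmb x‖ := by
  have h := norm_sq_planeEmb_add_perpEmb y x
  nlinarith [norm_nonneg y, norm_nonneg x, norm_nonneg (planeEmb y + perpEmb x)]

/-- A kernel continuous off `0` and bounded outside the unit ball is bounded on `{‖z‖ ≥ r}` for every `r > 0`
(compact annulus `r ≤ ‖z‖ ≤ 1`). -/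
theorem exists_bound_of_le_norm (hK : ContinuousOn K {x | x ≠ 0}) (hb : ∃ C : ℝ, ∀ x, 1 ≤ ‖x‖ → |K x| ≤ C)
    {r : ℝ} (hr : 0 < r) : ∃ M : ℝ, 0 ≤ M ∧ ∀ z : E4, r ≤ ‖z‖ → |K z| ≤ M := by
  obtain ⟨C, hC⟩ := hb
  have hcpt : IsCompact ({z : E4 | r ≤ ‖z‖} ∩ Metric.closedBall (0 : E4) 1) :=
    (isCompact_closedBall (0 : E4) 1).inter_left (isClosed_le continuous_const continuous_norm)
  have hsub : {z : E4 | r ≤ ‖z‖} ∩ Metric.closedBall (0 : E4) 1 ⊆ {x | x ≠ 0} := by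
    rintro z ⟨hz, -⟩ (rfl : z = 0)
    simp at hz; linarith
  obtain ⟨C', hC'⟩ := hcpt.exists_bound_of_continuousOn (hK.mono hsub)
  refine ⟨max (max C C') 0, le_max_right _ _, fun z hz => ?_⟩
  by_cases h1 : 1 ≤ ‖z‖
  · exact (hC z h1).trans ((le_max_left _ _).trans (le_max_left _ _))
  · have hz' : z ∈ {z : E4 | r ≤ ‖z‖} ∩ Metric.closedBall (0 : E4) 1 :=
      ⟨hz, by rw [Metric.mem_closedBall, dist_zero_right]; exact (not_le.1 h1).le⟩
    have := hC' z hz'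
    rw [Real.norm_eq_abs] at this
    exact this.trans ((le_max_right _ _).trans (le_max_left _ _))

/-! ## Continuity and boundedness of the slices -/

open Summit.QuantumFields.YangMills.Theorems.F4SubCurvatureDoorSliceFourier (integrable_exp_neg_half_sq_norm integrable_mul_gauss)

/-- **Conjunct 1**: every slice of a kernel continuous off `0` and bounded outside the unit ball is continuous off `0`
(dominated convergence: near `y₀ ≠ 0` the integrand is bounded by `M · e^{−‖x‖²/2}`). -/
theorem continuousOn_slice (hK : ContinuousOn K {x | x ≠ 0}) (hb : ∃ C : ℝ, ∀ x, 1 ≤ ‖x‖ → |K x| ≤ C) (a : E2) :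
    ContinuousOn (slice K a) {y | y ≠ 0} := by
  intro y₀ hy₀
  apply ContinuousAt.continuousWithinAt
  have hr : 0 < ‖y₀‖ / 2 := by have := norm_pos_iff.2 hy₀; positivity
  obtain ⟨M, hM0, hM⟩ := exists_bound_of_le_norm hK hb hr
  -- the neighbourhood `‖y − y₀‖ < ‖y₀‖/2`, on which `‖y‖ ≥ ‖y₀‖/2`
  have hnhds : ∀ᶠ y in 𝓝 y₀, ‖y₀‖ / 2 ≤ ‖y‖ := by
    have : Metric.ball y₀ (‖y₀‖ / 2) ∈ 𝓝 y₀ := Metric.ball_mem_nhds _ hr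
    filter_upwards [this] with y hy
    rw [Metric.mem_ball, dist_eq_norm] at hy
    have := norm_sub_norm_le y₀ y
    rw [← norm_neg (y₀ - y), neg_sub] at this
    linarith
  have hne : ∀ y : E2, ‖y₀‖ / 2 ≤ ‖y‖ → y ≠ 0 := fun y hy h => by
    rw [h, norm_zero] at hy; linarith
  unfold slice
  refine continuousAt_of_dominated (bound := fun x => M * Real.exp (-(‖x‖ ^ 2 / 2))) ?_ ?_ ?_ ?_
  · filter_upwards [hnhds] with y hy
    exact ((continuous_comp_slice hK (hne y hy)).mul (continuous_weight a)).aestronglyMeasurable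
  · filter_upwards [hnhds] with y hy
    refine ae_of_all _ fun x => ?_
    rw [Real.norm_eq_abs, abs_mul]
    exact mul_le_mul (hM _ (hy.trans (norm_le_norm_planeEmb_add_perpEmb y x))) (abs_weight_le a x) (abs_nonneg _) hM0
  · exact integrable_exp_neg_half_sq_norm.const_mul M
  · refine ae_of_all _ fun x => ?_
    have hz : planeEmb y₀ + perpEmb x ≠ 0 := planeEmb_add_perpEmb_ne_zero hy₀ x
    have hKc : ContinuousAt K (planeEmb y₀ + perpEmb x) := hK.continuousAt (isOpen_ne.mem_nhds hz)
    exact (hKc.comp_of_eq ((continuous_planeEmb.add continuous_const).continuousAt) rfl).mul continuousAt_const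

/-- **Conjunct 2**: every slice of a kernel bounded by `C` outside the unit ball is bounded by `C⁺ · ∫ e^{−‖x‖²/2}` on `‖y‖ ≥ 1`. -/
theorem exists_bound_slice (hb : ∃ C : ℝ, ∀ x, 1 ≤ ‖x‖ → |K x| ≤ C) (a : E2) :
    ∃ C : ℝ, ∀ y : E2, 1 ≤ ‖y‖ → |slice K a y| ≤ C := by
  obtain ⟨C, hC⟩ := hb
  refine ⟨max C 0 * ∫ x : E2, Real.exp (-(‖x‖ ^ 2 / 2)), fun y hy => ?_⟩
  unfold slice
  rw [← Real.norm_eq_abs, ← integral_const_mul]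
  refine norm_integral_le_of_norm_le (integrable_exp_neg_half_sq_norm.const_mul _) (ae_of_all _ fun x => ?_)
  rw [Real.norm_eq_abs, abs_mul]
  exact mul_le_mul ((hC _ (hy.trans (norm_le_norm_planeEmb_add_perpEmb y x))).trans (le_max_left _ _))
    (abs_weight_le a x) (abs_nonneg _) (le_max_right _ _)

/-! ## The sub-curvature budget of the slices -/

/-- The integrable profile `((1 + ‖v‖²)^4)⁻¹` on `ℝ²` (`8 > 2 = dim`). -/
theorem integrable_inv_one_add_norm_sq_pow_four : Integrable (fun v : E2 => ((1 + ‖v‖ ^ 2) ^ 4)⁻¹) := by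
  have h := integrable_rpow_neg_one_add_norm_sq (E := E2) (μ := volume) (r := 8)
    (by rw [finrank_euclideanSpace_fin]; norm_num)
  refine h.congr (ae_of_all _ fun v => ?_)
  simp only
  rw [show (-8 / 2 : ℝ) = -((4 : ℕ) : ℝ) by norm_num, Real.rpow_neg (by positivity), Real.rpow_natCast]

/-- Scaling of the profile: `((s² + ‖x‖²)^4)⁻¹ = s⁻⁸ · ((1 + ‖s⁻¹x‖²)^4)⁻¹`. -/
theorem inv_sq_add_norm_sq_pow_four_eq {s : ℝ} (hs : 0 < s) (x : E2) :
    ((s ^ 2 + ‖x‖ ^ 2) ^ 4)⁻¹ = (s ^ 8)⁻¹ * ((1 + ‖s⁻¹ • x‖ ^ 2) ^ 4)⁻¹ := by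
  rw [norm_smul, norm_inv, Real.norm_eq_abs, abs_of_pos hs]
  have hs0 : s ≠ 0 := hs.ne'
  have : s ^ 2 + ‖x‖ ^ 2 = s ^ 2 * (1 + (s⁻¹ * ‖x‖) ^ 2) := by field_simp
  rw [this, mul_pow, mul_inv]
  ring

/-- Integrability of `x ↦ ((s² + ‖x‖²)^4)⁻¹` on `ℝ²` for `s > 0`. -/
theorem integrable_inv_sq_add_norm_sq_pow_four {s : ℝ} (hs : 0 < s) :
    Integrable (fun x : E2 => ((s ^ 2 + ‖x‖ ^ 2) ^ 4)⁻¹) := by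
  simp_rw [inv_sq_add_norm_sq_pow_four_eq hs]
  exact (integrable_inv_one_add_norm_sq_pow_four.comp_smul (inv_ne_zero hs.ne')).const_mul _

/-- ★ Scaling identity: `∫_{ℝ²} ((s² + ‖x‖²)^4)⁻¹ dx = s⁻⁶ · ∫_{ℝ²} ((1 + ‖v‖²)^4)⁻¹ dv` (`x = s v`). -/
theorem integral_inv_sq_add_norm_sq_pow_four {s : ℝ} (hs : 0 < s) :
    ∫ x : E2, ((s ^ 2 + ‖x‖ ^ 2) ^ 4)⁻¹ = (s ^ 6)⁻¹ * ∫ v : E2, ((1 + ‖v‖ ^ 2) ^ 4)⁻¹ := by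
  simp_rw [inv_sq_add_norm_sq_pow_four_eq hs]
  rw [integral_const_mul, Measure.integral_comp_inv_smul_of_nonneg volume (fun v : E2 => ((1 + ‖v‖ ^ 2) ^ 4)⁻¹) hs.le,
    finrank_euclideanSpace_fin, smul_eq_mul, ← mul_assoc]
  congr 1
  have hs0 : s ≠ 0 := hs.ne'
  field_simp

/-- **Conjunct 7**: the planar sub-curvature budget `‖y‖⁶ · slice K a y → 0` (`y → 0`, `y ≠ 0`) for a kernel continuous off `0`,
bounded outside the unit ball, with the four-dimensional budget `‖z‖⁸ K z → 0`: for `η > 0` the integrand is bounded by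
`η ((‖y‖² + ‖x‖²)^4)⁻¹ + M_{δ/2} e^{−‖x‖²/2}` once `‖y‖ < δ/2`, and `∫ ((‖y‖² + ‖x‖²)^4)⁻¹ dx = ‖y‖⁻⁶ ∫ ((1 + ‖v‖²)^4)⁻¹ dv`. -/
theorem tendsto_norm_pow_six_mul_slice (hK : ContinuousOn K {x | x ≠ 0}) (hb : ∃ C : ℝ, ∀ x, 1 ≤ ‖x‖ → |K x| ≤ C)
    (hbud : Tendsto (fun x : E4 => ‖x‖ ^ 8 * K x) (𝓝[≠] 0) (𝓝 0)) (a : E2) :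
    Tendsto (fun y : E2 => ‖y‖ ^ 6 * slice K a y) (𝓝[≠] 0) (𝓝 0) := by
  rw [Metric.tendsto_nhdsWithin_nhds]
  intro ε hε
  obtain ⟨I, hI0, hIdef⟩ : ∃ I : ℝ, 0 ≤ I ∧ ∫ v : E2, ((1 + ‖v‖ ^ 2) ^ 4)⁻¹ = I :=
    ⟨_, integral_nonneg fun v => by positivity, rfl⟩
  obtain ⟨G, hG0, hGdef⟩ : ∃ G : ℝ, 0 ≤ G ∧ ∫ x : E2, Real.exp (-(‖x‖ ^ 2 / 2)) = G :=
    ⟨_, integral_nonneg fun x => (Real.exp_pos _).le, rfl⟩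
  -- small-scale control from the four-dimensional budget
  obtain ⟨η, hη0, hηdef⟩ : ∃ η : ℝ, 0 < η ∧ η = ε / (2 * (I + 1)) := ⟨_, div_pos hε (by linarith), rfl⟩
  obtain ⟨δ, hδ0, hδ⟩ := (Metric.tendsto_nhdsWithin_nhds.1 hbud) η hη0
  obtain ⟨M, hM0, hM⟩ := exists_bound_of_le_norm hK hb (half_pos hδ0)
  have hMG : 0 ≤ M * G := mul_nonneg hM0 hG0
  have hρ0 : 0 < ε / (2 * (M * G + 1)) := div_pos hε (by linarith)
  refine ⟨min (δ / 2) (min 1 (ε / (2 * (M * G + 1)))), lt_min (half_pos hδ0) (lt_min one_pos hρ0),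
    fun y hy hyd => ?_⟩
  have hy0 : y ≠ 0 := Set.mem_compl_singleton_iff.1 hy
  have hypos : 0 < ‖y‖ := norm_pos_iff.2 hy0
  rw [dist_zero_right] at hyd
  have hyδ : ‖y‖ < δ / 2 := lt_of_lt_of_le hyd (min_le_left _ _)
  have hy1 : ‖y‖ < 1 := lt_of_lt_of_le hyd ((min_le_right _ _).trans (min_le_left _ _))
  have hyε : ‖y‖ < ε / (2 * (M * G + 1)) := lt_of_lt_of_le hyd ((min_le_right _ _).trans (min_le_right _ _))
  -- pointwise bound of the integrand
  have hpt : ∀ x : E2, ‖K (planeEmb y + perpEmb x) * weight a x‖ ≤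
      η * ((‖y‖ ^ 2 + ‖x‖ ^ 2) ^ 4)⁻¹ + M * Real.exp (-(‖x‖ ^ 2 / 2)) := by
    intro x
    rw [Real.norm_eq_abs, abs_mul]
    have hw := abs_weight_le a x
    have hw1 : |weight a x| ≤ 1 :=
      hw.trans (Real.exp_le_one_iff.2 (by have := sq_nonneg ‖x‖; linarith))
    have hP : 0 < (‖y‖ ^ 2 + ‖x‖ ^ 2) ^ 4 := pow_pos (add_pos_of_pos_of_nonneg (pow_pos hypos 2) (sq_nonneg _)) 4
    have hA0 : 0 ≤ η * ((‖y‖ ^ 2 + ‖x‖ ^ 2) ^ 4)⁻¹ := mul_nonneg hη0.le (inv_nonneg.2 hP.le)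
    have hB0 : 0 ≤ M * Real.exp (-(‖x‖ ^ 2 / 2)) := mul_nonneg hM0 (Real.exp_pos _).le
    by_cases hx : ‖x‖ < δ / 2
    · -- small `x`: the budget
      have hz0 : planeEmb y + perpEmb x ≠ 0 := planeEmb_add_perpEmb_ne_zero hy0 x
      have hzn : ‖planeEmb y + perpEmb x‖ ^ 2 = ‖y‖ ^ 2 + ‖x‖ ^ 2 := norm_sq_planeEmb_add_perpEmb y x
      have hzδ : ‖planeEmb y + perpEmb x‖ < δ := by
        have h1 : ‖y‖ ^ 2 < (δ / 2) ^ 2 := pow_lt_pow_left₀ hyδ hypos.le two_ne_zero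
        have h2 : ‖x‖ ^ 2 < (δ / 2) ^ 2 := pow_lt_pow_left₀ hx (norm_nonneg _) two_ne_zero
        have h3 : ‖planeEmb y + perpEmb x‖ ^ 2 < δ ^ 2 := by rw [hzn]; nlinarith
        exact (pow_lt_pow_iff_left₀ (norm_nonneg _) hδ0.le two_ne_zero).1 h3
      have hKz : |‖planeEmb y + perpEmb x‖ ^ 8 * K (planeEmb y + perpEmb x)| < η := by
        have := hδ (Set.mem_compl_singleton_iff.2 hz0) (by rwa [dist_zero_right])
        rwa [dist_zero_right, Real.norm_eq_abs] at this
      have h8 : ‖planeEmb y + perpEmb x‖ ^ 8 = (‖y‖ ^ 2 + ‖x‖ ^ 2) ^ 4 := by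
        rw [show (8 : ℕ) = 2 * 4 by norm_num, pow_mul, hzn]
      rw [abs_mul, h8, abs_of_pos hP] at hKz
      have hK' : |K (planeEmb y + perpEmb x)| ≤ η * ((‖y‖ ^ 2 + ‖x‖ ^ 2) ^ 4)⁻¹ := by
        rw [← div_eq_mul_inv, le_div_iff₀ hP, mul_comm]
        exact hKz.le
      calc |K (planeEmb y + perpEmb x)| * |weight a x| ≤ η * ((‖y‖ ^ 2 + ‖x‖ ^ 2) ^ 4)⁻¹ * 1 :=
            mul_le_mul hK' hw1 (abs_nonneg _) hA0
        _ ≤ η * ((‖y‖ ^ 2 + ‖x‖ ^ 2) ^ 4)⁻¹ + M * Real.exp (-(‖x‖ ^ 2 / 2)) := by linarith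
    · -- large `x`: the annulus bound
      have hxz : δ / 2 ≤ ‖planeEmb y + perpEmb x‖ := (not_lt.1 hx).trans (norm_le_norm_planeEmb_add_perpEmb' y x)
      calc |K (planeEmb y + perpEmb x)| * |weight a x| ≤ M * Real.exp (-(‖x‖ ^ 2 / 2)) :=
            mul_le_mul (hM _ hxz) hw (abs_nonneg _) hM0
        _ ≤ η * ((‖y‖ ^ 2 + ‖x‖ ^ 2) ^ 4)⁻¹ + M * Real.exp (-(‖x‖ ^ 2 / 2)) := by linarith
  -- integrate the bound
  have hi1 : Integrable (fun x : E2 => η * ((‖y‖ ^ 2 + ‖x‖ ^ 2) ^ 4)⁻¹) :=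
    (integrable_inv_sq_add_norm_sq_pow_four hypos).const_mul η
  have hi2 : Integrable (fun x : E2 => M * Real.exp (-(‖x‖ ^ 2 / 2))) := integrable_exp_neg_half_sq_norm.const_mul M
  have hI1 : |slice K a y| ≤ η * ((‖y‖ ^ 6)⁻¹ * I) + M * G := by
    unfold slice
    rw [← Real.norm_eq_abs]
    refine (norm_integral_le_of_norm_le (hi1.add hi2) (ae_of_all _ hpt)).trans (le_of_eq ?_)
    show ∫ x : E2, (η * ((‖y‖ ^ 2 + ‖x‖ ^ 2) ^ 4)⁻¹ + M * Real.exp (-(‖x‖ ^ 2 / 2))) = _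
    rw [integral_add hi1 hi2, integral_const_mul, integral_const_mul, integral_inv_sq_add_norm_sq_pow_four hypos,
      hIdef, hGdef]
  -- conclude
  rw [dist_zero_right, Real.norm_eq_abs, abs_mul, abs_of_nonneg (pow_nonneg hypos.le 6)]
  have hy6 : ‖y‖ ^ 6 ≤ ‖y‖ := pow_le_of_le_one hypos.le hy1.le (by norm_num)
  have hne : (‖y‖ ^ 6) ≠ 0 := pow_ne_zero _ hypos.ne'
  have hA : η * I < ε / 2 := by
    have h1 : η * I < η * (I + 1) := mul_lt_mul_of_pos_left (by linarith) hη0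
    have h2 : η * (I + 1) = ε / 2 := by
      rw [hηdef, div_mul_eq_mul_div, mul_div_mul_right _ _ (by linarith : I + 1 ≠ 0)]
    linarith
  have hB : ‖y‖ ^ 6 * (M * G) ≤ ε / 2 := by
    have h1 : ‖y‖ ^ 6 * (M * G) ≤ ‖y‖ * (M * G) := mul_le_mul_of_nonneg_right hy6 hMG
    have h2 : ‖y‖ * (M * G) ≤ ε / (2 * (M * G + 1)) * (M * G) := mul_le_mul_of_nonneg_right hyε.le hMG
    have h3 : ε / (2 * (M * G + 1)) * (M * G) ≤ ε / (2 * (M * G + 1)) * (M * G + 1) :=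
      mul_le_mul_of_nonneg_left (by linarith) hρ0.le
    have h4 : ε / (2 * (M * G + 1)) * (M * G + 1) = ε / 2 := by
      rw [div_mul_eq_mul_div, mul_div_mul_right _ _ (by linarith : M * G + 1 ≠ 0)]
    linarith
  have hC : ‖y‖ ^ 6 * (η * ((‖y‖ ^ 6)⁻¹ * I) + M * G) = η * I + ‖y‖ ^ 6 * (M * G) := by
    have : ‖y‖ ^ 6 * (η * ((‖y‖ ^ 6)⁻¹ * I)) = η * (‖y‖ ^ 6 * (‖y‖ ^ 6)⁻¹) * I := by ring
    rw [mul_add, this, mul_inv_cancel₀ hne, mul_one]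
  calc ‖y‖ ^ 6 * |slice K a y| ≤ ‖y‖ ^ 6 * (η * ((‖y‖ ^ 6)⁻¹ * I) + M * G) :=
        mul_le_mul_of_nonneg_left hI1 (pow_nonneg hypos.le 6)
    _ = η * I + ‖y‖ ^ 6 * (M * G) := hC
    _ < ε := by linarith

end Summit.QuantumFields.YangMills.Theorems.F4SubCurvatureDoorSliceInClass

end
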